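import Summits.CriticalPhenomena.PercolationContinuityZ3.Theorems.PercNearOneGluingNoHeavyLowerTailQ44SingleSourceEMonoA
import Summits.CriticalPhenomena.PercolationContinuityZ3.Theorems.PercNearOneGluingNoHeavyLowerTailQ44bGluingAB
import Summits.CriticalPhenomena.PercolationContinuityZ3.Theorems.PercNearOneGluingNoHeavyLowerTailFourPointExchangeD
import Summits.CriticalPhenomena.PercolationContinuityZ3.Theorems.PercNearOneGluingNoHeavyLowerTailFourPointRelabelExchange

/-!
# E-MONO-A holds along the pencils of the terminal pairs `s(a,b)`, `s(a,c)`, `s(a,y)` (single-source law, all `n`)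

Support file for crux `stmt-CriticalPhenomena-4575` (master-family programme, row `Q44`, single-source packing; MONO-A
line), seat `prim-bnk-1` gen 33; memo `run/shared/lean/prim/prim-l12/FROM-prim-bnk-1-gen33-LAW-LEVEL-MONO-A.md` §4, §8.

`SingleSourceLaw.EMonoA` (`prim-l12-p6` gen 24, `…Q44SingleSourceEMonoA`) asks, for every pair `s(x,z)` whose end `x` is
surely joined to `a`, for the pencil inequality `bil(w₀,w₀) ≤ bil(w₀,w₁) + bil(w₁,w₀)` (`w₀ = w[e↦0]`, `w₁ = w[e↦1]`).  This
file proves it for the three TERMINAL pairs `e = s(a,b), s(a,c), s(a,y)` (`pencil_ab`, `pencil_ac`, `pencil_ay`), on `Fin n`: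

* `cell_update_one_ab/ac/ay` — gluing dictionaries: every cell of `w[e↦1]` as a sum of cells of `w[e↦0]`
  (`P_{w[e↦1]}(E) = P_{w[e↦0]}(ω ∪ {e} ∈ E)`, one-extra-edge reachability; pattern `p ↦ p ∨ e`); `cell_relabel_aybc/bcya` — cells of
  the relabelled quadruples `(a,y,b,c)`, `(b,c,y,a)` in the cells of `(a,b,c,y)` (`(a,c,b,y)` is `Q44TopGood.cell_relabel_acby` of the tree);
* `pencil_ab` — defect `c₀c₉ + c₀c₁₀ + c₅c₇ − c₁c₉ ≥ 0` by the type-D exchange inequality (`FourPointExchange.typeD_cell`);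
  `pencil_ac` — the `b↔c` image (type D for `(a,c,b,y)`); `pencil_ay` — two type-B instances and one type-D instance.
The pairs `s(x,z)` with `x ≠ a` in `a`'s sure cluster reduce to these by contraction (not formalised); the non-terminal pairs
are the open core step (memo §5).  No named facts, no sorries, no definitions.
-/

noncomputable section

namespace Summit.CriticalPhenomena.PercolationContinuityZ3.Theorems

namespace SingleSourceLaw

open MeasureTheory Set Literature.Probability.LatticeModels Literature.Probability.Percolation
open FourPointAtoms
open Summit.CriticalPhenomena.PercolationContinuityZ3.Cruxes.AdditiveGluing.TieLine.ConnAtoms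
open scoped Classical

variable {n : ℕ}

/-- **Pattern of `ω ∪ {s(a,b)}`**: the event "`ω ∪ {s(a,b)}` lies in the atom of `π₀`" is the pattern event
`∀ j k, ((π j = π k) ∨ (π j = π 0 ∧ π 1 = π k) ∨ (π j = π 1 ∧ π 0 = π k)) ↔ π₀ j = π₀ k`. [this work] -/
theorem hasPattern_insert_ab (a b c y : Fin n) (π₀ : Fin 4 → Fin 4) :
    HasPattern (quad a b c y) {ω : BondConfig (Fin n) | insert s(a, b) ω ∈ atom (quad a b c y) π₀}
      (fun π => ∀ j k : Fin 4, ((π j = π k) ∨ (π j = π 0 ∧ π 1 = π k) ∨ (π j = π 1 ∧ π 0 = π k)) ↔ π₀ j = π₀ k) := by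
  intro π _ ω hω
  simp only [Set.mem_setOf_eq, mem_atom]
  have hω' : ∀ j k : Fin 4, (openGraph ω).Reachable (quad a b c y j) (quad a b c y k) ↔ π j = π k := hω
  have ha0 : ∀ j : Fin 4, (openGraph ω).Reachable (quad a b c y j) a ↔ π j = π 0 := fun j => hω j 0
  have hb1 : ∀ k : Fin 4, (openGraph ω).Reachable b (quad a b c y k) ↔ π 1 = π k := fun k => hω 1 k
  have hb1' : ∀ j : Fin 4, (openGraph ω).Reachable (quad a b c y j) b ↔ π j = π 1 := fun j => hω j 1
  have ha0' : ∀ k : Fin 4, (openGraph ω).Reachable a (quad a b c y k) ↔ π 0 = π k := fun k => hω 0 k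
  simp only [KNSep.reachable_insert_iff, hω', ha0, hb1, hb1', ha0']

/-- **Gluing dictionary for `s(a,b)`**: a cell of `w[s(a,b)↦1]` is the `w[s(a,b)↦0]`-probability that `ω ∪ {s(a,b)}` has
that pattern, written out as a sum of cells of `w₀ = w[s(a,b)↦0]` (pattern `p ↦ p ∨ ab`). [this work] -/
theorem cell_update_one_ab (w : Sym2 (Fin n) → unitInterval) (a b c y : Fin n) (i : Fin 15) :
    cell (Function.update w s(a, b) 1) a b c y i =
      (if (∀ j k : Fin 4, ((pat4 0 j = pat4 0 k) ∨ (pat4 0 j = pat4 0 0 ∧ pat4 0 1 = pat4 0 k) ∨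
          (pat4 0 j = pat4 0 1 ∧ pat4 0 0 = pat4 0 k)) ↔ pat4 i j = pat4 i k) then cell (Function.update w s(a, b) 0) a b c y 0 else 0) +
      (if (∀ j k : Fin 4, ((pat4 1 j = pat4 1 k) ∨ (pat4 1 j = pat4 1 0 ∧ pat4 1 1 = pat4 1 k) ∨
          (pat4 1 j = pat4 1 1 ∧ pat4 1 0 = pat4 1 k)) ↔ pat4 i j = pat4 i k) then cell (Function.update w s(a, b) 0) a b c y 1 else 0) +
      (if (∀ j k : Fin 4, ((pat4 2 j = pat4 2 k) ∨ (pat4 2 j = pat4 2 0 ∧ pat4 2 1 = pat4 2 k) ∨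
          (pat4 2 j = pat4 2 1 ∧ pat4 2 0 = pat4 2 k)) ↔ pat4 i j = pat4 i k) then cell (Function.update w s(a, b) 0) a b c y 2 else 0) +
      (if (∀ j k : Fin 4, ((pat4 3 j = pat4 3 k) ∨ (pat4 3 j = pat4 3 0 ∧ pat4 3 1 = pat4 3 k) ∨
          (pat4 3 j = pat4 3 1 ∧ pat4 3 0 = pat4 3 k)) ↔ pat4 i j = pat4 i k) then cell (Function.update w s(a, b) 0) a b c y 3 else 0) +
      (if (∀ j k : Fin 4, ((pat4 4 j = pat4 4 k) ∨ (pat4 4 j = pat4 4 0 ∧ pat4 4 1 = pat4 4 k) ∨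
          (pat4 4 j = pat4 4 1 ∧ pat4 4 0 = pat4 4 k)) ↔ pat4 i j = pat4 i k) then cell (Function.update w s(a, b) 0) a b c y 4 else 0) +
      (if (∀ j k : Fin 4, ((pat4 5 j = pat4 5 k) ∨ (pat4 5 j = pat4 5 0 ∧ pat4 5 1 = pat4 5 k) ∨
          (pat4 5 j = pat4 5 1 ∧ pat4 5 0 = pat4 5 k)) ↔ pat4 i j = pat4 i k) then cell (Function.update w s(a, b) 0) a b c y 5 else 0) +
      (if (∀ j k : Fin 4, ((pat4 6 j = pat4 6 k) ∨ (pat4 6 j = pat4 6 0 ∧ pat4 6 1 = pat4 6 k) ∨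
          (pat4 6 j = pat4 6 1 ∧ pat4 6 0 = pat4 6 k)) ↔ pat4 i j = pat4 i k) then cell (Function.update w s(a, b) 0) a b c y 6 else 0) +
      (if (∀ j k : Fin 4, ((pat4 7 j = pat4 7 k) ∨ (pat4 7 j = pat4 7 0 ∧ pat4 7 1 = pat4 7 k) ∨
          (pat4 7 j = pat4 7 1 ∧ pat4 7 0 = pat4 7 k)) ↔ pat4 i j = pat4 i k) then cell (Function.update w s(a, b) 0) a b c y 7 else 0) +
      (if (∀ j k : Fin 4, ((pat4 8 j = pat4 8 k) ∨ (pat4 8 j = pat4 8 0 ∧ pat4 8 1 = pat4 8 k) ∨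
          (pat4 8 j = pat4 8 1 ∧ pat4 8 0 = pat4 8 k)) ↔ pat4 i j = pat4 i k) then cell (Function.update w s(a, b) 0) a b c y 8 else 0) +
      (if (∀ j k : Fin 4, ((pat4 9 j = pat4 9 k) ∨ (pat4 9 j = pat4 9 0 ∧ pat4 9 1 = pat4 9 k) ∨
          (pat4 9 j = pat4 9 1 ∧ pat4 9 0 = pat4 9 k)) ↔ pat4 i j = pat4 i k) then cell (Function.update w s(a, b) 0) a b c y 9 else 0) +
      (if (∀ j k : Fin 4, ((pat4 10 j = pat4 10 k) ∨ (pat4 10 j = pat4 10 0 ∧ pat4 10 1 = pat4 10 k) ∨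
          (pat4 10 j = pat4 10 1 ∧ pat4 10 0 = pat4 10 k)) ↔ pat4 i j = pat4 i k) then cell (Function.update w s(a, b) 0) a b c y 10 else 0) +
      (if (∀ j k : Fin 4, ((pat4 11 j = pat4 11 k) ∨ (pat4 11 j = pat4 11 0 ∧ pat4 11 1 = pat4 11 k) ∨
          (pat4 11 j = pat4 11 1 ∧ pat4 11 0 = pat4 11 k)) ↔ pat4 i j = pat4 i k) then cell (Function.update w s(a, b) 0) a b c y 11 else 0) +
      (if (∀ j k : Fin 4, ((pat4 12 j = pat4 12 k) ∨ (pat4 12 j = pat4 12 0 ∧ pat4 12 1 = pat4 12 k) ∨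
          (pat4 12 j = pat4 12 1 ∧ pat4 12 0 = pat4 12 k)) ↔ pat4 i j = pat4 i k) then cell (Function.update w s(a, b) 0) a b c y 12 else 0) +
      (if (∀ j k : Fin 4, ((pat4 13 j = pat4 13 k) ∨ (pat4 13 j = pat4 13 0 ∧ pat4 13 1 = pat4 13 k) ∨
          (pat4 13 j = pat4 13 1 ∧ pat4 13 0 = pat4 13 k)) ↔ pat4 i j = pat4 i k) then cell (Function.update w s(a, b) 0) a b c y 13 else 0) +
      (if (∀ j k : Fin 4, ((pat4 14 j = pat4 14 k) ∨ (pat4 14 j = pat4 14 0 ∧ pat4 14 1 = pat4 14 k) ∨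
          (pat4 14 j = pat4 14 1 ∧ pat4 14 0 = pat4 14 k)) ↔ pat4 i j = pat4 i k) then cell (Function.update w s(a, b) 0) a b c y 14 else 0) := by
  have glue : (prodBernoulli (Function.update w s(a, b) 1)).real (atom (quad a b c y) (pat4 i)) =
      (prodBernoulli (Function.update w s(a, b) 0)).real
        {ω : BondConfig (Fin n) | insert s(a, b) ω ∈ atom (quad a b c y) (pat4 i)} := by
    have h1 : Function.update w s(a, b) 1 = Function.update (Function.update w s(a, b) 0) s(a, b) 1 := by
      simp only [Function.update_idem]
    rw [h1]
    exact prodBernoulli_real_update_one_eq (TargetExploration.determinedBy_univ _) (Function.update w s(a, b) 0)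
      (Finset.mem_univ _)
  unfold cell
  rw [glue, measureReal_eq_cellSum (Function.update w s(a, b) 0) a b c y (hasPattern_insert_ab a b c y (pat4 i))]
  rfl

/-- **E-MONO-A along the pencil of `s(a,b)`** (all `n`, all weightings): with `w₀ = w[s(a,b)↦0]`, `w₁ = w[s(a,b)↦1]`,
`bil w₀ w₀ ≤ bil w₀ w₁ + bil w₁ w₀` — the defect is `c₀c₉ + c₀c₁₀ + c₅c₇ − c₁c₉ ≥ 0` in the cells of `w₀` by the type-D
exchange inequality. [this work] -/
theorem pencil_ab (w : Sym2 (Fin n) → unitInterval) (a b c y : Fin n) :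
    bil (Function.update w s(a, b) 0) (Function.update w s(a, b) 0) a b c y ≤
      bil (Function.update w s(a, b) 0) (Function.update w s(a, b) 1) a b c y +
        bil (Function.update w s(a, b) 1) (Function.update w s(a, b) 0) a b c y := by
  have hD := FourPointExchange.typeD_cell (Function.update w s(a, b) 0) a b c y
  have h0 := cell_update_one_ab w a b c y 0; have h1 := cell_update_one_ab w a b c y 1
  have h5 := cell_update_one_ab w a b c y 5; have h6 := cell_update_one_ab w a b c y 6
  have h7 := cell_update_one_ab w a b c y 7; have h8 := cell_update_one_ab w a b c y 8
  have h9 := cell_update_one_ab w a b c y 9; have h11 := cell_update_one_ab w a b c y 11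
  have h14 := cell_update_one_ab w a b c y 14
  simp (config := {decide := true}) only [ite_true, ite_false, add_zero, zero_add] at h0 h1 h5 h6 h7 h8 h9 h11 h14
  have p0 := cell_nonneg (Function.update w s(a, b) 0) a b c y 0; have p9 := cell_nonneg (Function.update w s(a, b) 0) a b c y 9
  have p10 := cell_nonneg (Function.update w s(a, b) 0) a b c y 10
  unfold bil
  rw [h0, h1, h5, h6, h7, h8, h9, h11, h14]
  nlinarith [hD, mul_nonneg p0 p9, mul_nonneg p0 p10]

/-- Pattern of `ω ∪ {s(a,c)}` (indices `0`, `2` of the marked points). [this work] -/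
theorem hasPattern_insert_ac (a b c y : Fin n) (π₀ : Fin 4 → Fin 4) :
    HasPattern (quad a b c y) {ω : BondConfig (Fin n) | insert s(a, c) ω ∈ atom (quad a b c y) π₀}
      (fun π => ∀ j k : Fin 4, ((π j = π k) ∨ (π j = π 0 ∧ π 2 = π k) ∨ (π j = π 2 ∧ π 0 = π k)) ↔ π₀ j = π₀ k) := by
  intro π _ ω hω
  simp only [Set.mem_setOf_eq, mem_atom]
  have hω' : ∀ j k : Fin 4, (openGraph ω).Reachable (quad a b c y j) (quad a b c y k) ↔ π j = π k := hω
  have h0 : ∀ j : Fin 4, (openGraph ω).Reachable (quad a b c y j) a ↔ π j = π 0 := fun j => hω j 0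
  have h1 : ∀ k : Fin 4, (openGraph ω).Reachable c (quad a b c y k) ↔ π 2 = π k := fun k => hω 2 k
  have h1' : ∀ j : Fin 4, (openGraph ω).Reachable (quad a b c y j) c ↔ π j = π 2 := fun j => hω j 2
  have h0' : ∀ k : Fin 4, (openGraph ω).Reachable a (quad a b c y k) ↔ π 0 = π k := fun k => hω 0 k
  simp only [KNSep.reachable_insert_iff, hω', h0, h1, h1', h0']

/-- Gluing dictionary for `s(a,c)`: the cells of `w[s(a,c)↦1]` as sums of cells of `w[s(a,c)↦0]`. [this work] -/
theorem cell_update_one_ac (w : Sym2 (Fin n) → unitInterval) (a b c y : Fin n) (i : Fin 15) :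
    cell (Function.update w s(a, c) 1) a b c y i =
      (if (∀ j k : Fin 4, ((pat4 0 j = pat4 0 k) ∨ (pat4 0 j = pat4 0 0 ∧ pat4 0 2 = pat4 0 k) ∨
          (pat4 0 j = pat4 0 2 ∧ pat4 0 0 = pat4 0 k)) ↔ pat4 i j = pat4 i k) then cell (Function.update w s(a, c) 0) a b c y 0 else 0) +
      (if (∀ j k : Fin 4, ((pat4 1 j = pat4 1 k) ∨ (pat4 1 j = pat4 1 0 ∧ pat4 1 2 = pat4 1 k) ∨
          (pat4 1 j = pat4 1 2 ∧ pat4 1 0 = pat4 1 k)) ↔ pat4 i j = pat4 i k) then cell (Function.update w s(a, c) 0) a b c y 1 else 0) +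
      (if (∀ j k : Fin 4, ((pat4 2 j = pat4 2 k) ∨ (pat4 2 j = pat4 2 0 ∧ pat4 2 2 = pat4 2 k) ∨
          (pat4 2 j = pat4 2 2 ∧ pat4 2 0 = pat4 2 k)) ↔ pat4 i j = pat4 i k) then cell (Function.update w s(a, c) 0) a b c y 2 else 0) +
      (if (∀ j k : Fin 4, ((pat4 3 j = pat4 3 k) ∨ (pat4 3 j = pat4 3 0 ∧ pat4 3 2 = pat4 3 k) ∨
          (pat4 3 j = pat4 3 2 ∧ pat4 3 0 = pat4 3 k)) ↔ pat4 i j = pat4 i k) then cell (Function.update w s(a, c) 0) a b c y 3 else 0) +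
      (if (∀ j k : Fin 4, ((pat4 4 j = pat4 4 k) ∨ (pat4 4 j = pat4 4 0 ∧ pat4 4 2 = pat4 4 k) ∨
          (pat4 4 j = pat4 4 2 ∧ pat4 4 0 = pat4 4 k)) ↔ pat4 i j = pat4 i k) then cell (Function.update w s(a, c) 0) a b c y 4 else 0) +
      (if (∀ j k : Fin 4, ((pat4 5 j = pat4 5 k) ∨ (pat4 5 j = pat4 5 0 ∧ pat4 5 2 = pat4 5 k) ∨
          (pat4 5 j = pat4 5 2 ∧ pat4 5 0 = pat4 5 k)) ↔ pat4 i j = pat4 i k) then cell (Function.update w s(a, c) 0) a b c y 5 else 0) +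
      (if (∀ j k : Fin 4, ((pat4 6 j = pat4 6 k) ∨ (pat4 6 j = pat4 6 0 ∧ pat4 6 2 = pat4 6 k) ∨
          (pat4 6 j = pat4 6 2 ∧ pat4 6 0 = pat4 6 k)) ↔ pat4 i j = pat4 i k) then cell (Function.update w s(a, c) 0) a b c y 6 else 0) +
      (if (∀ j k : Fin 4, ((pat4 7 j = pat4 7 k) ∨ (pat4 7 j = pat4 7 0 ∧ pat4 7 2 = pat4 7 k) ∨
          (pat4 7 j = pat4 7 2 ∧ pat4 7 0 = pat4 7 k)) ↔ pat4 i j = pat4 i k) then cell (Function.update w s(a, c) 0) a b c y 7 else 0) +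
      (if (∀ j k : Fin 4, ((pat4 8 j = pat4 8 k) ∨ (pat4 8 j = pat4 8 0 ∧ pat4 8 2 = pat4 8 k) ∨
          (pat4 8 j = pat4 8 2 ∧ pat4 8 0 = pat4 8 k)) ↔ pat4 i j = pat4 i k) then cell (Function.update w s(a, c) 0) a b c y 8 else 0) +
      (if (∀ j k : Fin 4, ((pat4 9 j = pat4 9 k) ∨ (pat4 9 j = pat4 9 0 ∧ pat4 9 2 = pat4 9 k) ∨
          (pat4 9 j = pat4 9 2 ∧ pat4 9 0 = pat4 9 k)) ↔ pat4 i j = pat4 i k) then cell (Function.update w s(a, c) 0) a b c y 9 else 0) +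
      (if (∀ j k : Fin 4, ((pat4 10 j = pat4 10 k) ∨ (pat4 10 j = pat4 10 0 ∧ pat4 10 2 = pat4 10 k) ∨
          (pat4 10 j = pat4 10 2 ∧ pat4 10 0 = pat4 10 k)) ↔ pat4 i j = pat4 i k) then cell (Function.update w s(a, c) 0) a b c y 10 else 0) +
      (if (∀ j k : Fin 4, ((pat4 11 j = pat4 11 k) ∨ (pat4 11 j = pat4 11 0 ∧ pat4 11 2 = pat4 11 k) ∨
          (pat4 11 j = pat4 11 2 ∧ pat4 11 0 = pat4 11 k)) ↔ pat4 i j = pat4 i k) then cell (Function.update w s(a, c) 0) a b c y 11 else 0) +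
      (if (∀ j k : Fin 4, ((pat4 12 j = pat4 12 k) ∨ (pat4 12 j = pat4 12 0 ∧ pat4 12 2 = pat4 12 k) ∨
          (pat4 12 j = pat4 12 2 ∧ pat4 12 0 = pat4 12 k)) ↔ pat4 i j = pat4 i k) then cell (Function.update w s(a, c) 0) a b c y 12 else 0) +
      (if (∀ j k : Fin 4, ((pat4 13 j = pat4 13 k) ∨ (pat4 13 j = pat4 13 0 ∧ pat4 13 2 = pat4 13 k) ∨
          (pat4 13 j = pat4 13 2 ∧ pat4 13 0 = pat4 13 k)) ↔ pat4 i j = pat4 i k) then cell (Function.update w s(a, c) 0) a b c y 13 else 0) +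
      (if (∀ j k : Fin 4, ((pat4 14 j = pat4 14 k) ∨ (pat4 14 j = pat4 14 0 ∧ pat4 14 2 = pat4 14 k) ∨
          (pat4 14 j = pat4 14 2 ∧ pat4 14 0 = pat4 14 k)) ↔ pat4 i j = pat4 i k) then cell (Function.update w s(a, c) 0) a b c y 14 else 0) := by
  have glue : (prodBernoulli (Function.update w s(a, c) 1)).real (atom (quad a b c y) (pat4 i)) =
      (prodBernoulli (Function.update w s(a, c) 0)).real
        {ω : BondConfig (Fin n) | insert s(a, c) ω ∈ atom (quad a b c y) (pat4 i)} := by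
    have h1 : Function.update w s(a, c) 1 = Function.update (Function.update w s(a, c) 0) s(a, c) 1 := by
      simp only [Function.update_idem]
    rw [h1]
    exact prodBernoulli_real_update_one_eq (TargetExploration.determinedBy_univ _) (Function.update w s(a, c) 0)
      (Finset.mem_univ _)
  unfold cell
  rw [glue, measureReal_eq_cellSum (Function.update w s(a, c) 0) a b c y (hasPattern_insert_ac a b c y (pat4 i))]
  rfl

/-- Pattern of `ω ∪ {s(a,y)}` (indices `0`, `3` of the marked points). [this work] -/
theorem hasPattern_insert_ay (a b c y : Fin n) (π₀ : Fin 4 → Fin 4) :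
    HasPattern (quad a b c y) {ω : BondConfig (Fin n) | insert s(a, y) ω ∈ atom (quad a b c y) π₀}
      (fun π => ∀ j k : Fin 4, ((π j = π k) ∨ (π j = π 0 ∧ π 3 = π k) ∨ (π j = π 3 ∧ π 0 = π k)) ↔ π₀ j = π₀ k) := by
  intro π _ ω hω
  simp only [Set.mem_setOf_eq, mem_atom]
  have hω' : ∀ j k : Fin 4, (openGraph ω).Reachable (quad a b c y j) (quad a b c y k) ↔ π j = π k := hω
  have h0 : ∀ j : Fin 4, (openGraph ω).Reachable (quad a b c y j) a ↔ π j = π 0 := fun j => hω j 0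
  have h1 : ∀ k : Fin 4, (openGraph ω).Reachable y (quad a b c y k) ↔ π 3 = π k := fun k => hω 3 k
  have h1' : ∀ j : Fin 4, (openGraph ω).Reachable (quad a b c y j) y ↔ π j = π 3 := fun j => hω j 3
  have h0' : ∀ k : Fin 4, (openGraph ω).Reachable a (quad a b c y k) ↔ π 0 = π k := fun k => hω 0 k
  simp only [KNSep.reachable_insert_iff, hω', h0, h1, h1', h0']

/-- Gluing dictionary for `s(a,y)`: the cells of `w[s(a,y)↦1]` as sums of cells of `w[s(a,y)↦0]`. [this work] -/
theorem cell_update_one_ay (w : Sym2 (Fin n) → unitInterval) (a b c y : Fin n) (i : Fin 15) :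
    cell (Function.update w s(a, y) 1) a b c y i =
      (if (∀ j k : Fin 4, ((pat4 0 j = pat4 0 k) ∨ (pat4 0 j = pat4 0 0 ∧ pat4 0 3 = pat4 0 k) ∨
          (pat4 0 j = pat4 0 3 ∧ pat4 0 0 = pat4 0 k)) ↔ pat4 i j = pat4 i k) then cell (Function.update w s(a, y) 0) a b c y 0 else 0) +
      (if (∀ j k : Fin 4, ((pat4 1 j = pat4 1 k) ∨ (pat4 1 j = pat4 1 0 ∧ pat4 1 3 = pat4 1 k) ∨
          (pat4 1 j = pat4 1 3 ∧ pat4 1 0 = pat4 1 k)) ↔ pat4 i j = pat4 i k) then cell (Function.update w s(a, y) 0) a b c y 1 else 0) +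
      (if (∀ j k : Fin 4, ((pat4 2 j = pat4 2 k) ∨ (pat4 2 j = pat4 2 0 ∧ pat4 2 3 = pat4 2 k) ∨
          (pat4 2 j = pat4 2 3 ∧ pat4 2 0 = pat4 2 k)) ↔ pat4 i j = pat4 i k) then cell (Function.update w s(a, y) 0) a b c y 2 else 0) +
      (if (∀ j k : Fin 4, ((pat4 3 j = pat4 3 k) ∨ (pat4 3 j = pat4 3 0 ∧ pat4 3 3 = pat4 3 k) ∨
          (pat4 3 j = pat4 3 3 ∧ pat4 3 0 = pat4 3 k)) ↔ pat4 i j = pat4 i k) then cell (Function.update w s(a, y) 0) a b c y 3 else 0) +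
      (if (∀ j k : Fin 4, ((pat4 4 j = pat4 4 k) ∨ (pat4 4 j = pat4 4 0 ∧ pat4 4 3 = pat4 4 k) ∨
          (pat4 4 j = pat4 4 3 ∧ pat4 4 0 = pat4 4 k)) ↔ pat4 i j = pat4 i k) then cell (Function.update w s(a, y) 0) a b c y 4 else 0) +
      (if (∀ j k : Fin 4, ((pat4 5 j = pat4 5 k) ∨ (pat4 5 j = pat4 5 0 ∧ pat4 5 3 = pat4 5 k) ∨
          (pat4 5 j = pat4 5 3 ∧ pat4 5 0 = pat4 5 k)) ↔ pat4 i j = pat4 i k) then cell (Function.update w s(a, y) 0) a b c y 5 else 0) +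
      (if (∀ j k : Fin 4, ((pat4 6 j = pat4 6 k) ∨ (pat4 6 j = pat4 6 0 ∧ pat4 6 3 = pat4 6 k) ∨
          (pat4 6 j = pat4 6 3 ∧ pat4 6 0 = pat4 6 k)) ↔ pat4 i j = pat4 i k) then cell (Function.update w s(a, y) 0) a b c y 6 else 0) +
      (if (∀ j k : Fin 4, ((pat4 7 j = pat4 7 k) ∨ (pat4 7 j = pat4 7 0 ∧ pat4 7 3 = pat4 7 k) ∨
          (pat4 7 j = pat4 7 3 ∧ pat4 7 0 = pat4 7 k)) ↔ pat4 i j = pat4 i k) then cell (Function.update w s(a, y) 0) a b c y 7 else 0) +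
      (if (∀ j k : Fin 4, ((pat4 8 j = pat4 8 k) ∨ (pat4 8 j = pat4 8 0 ∧ pat4 8 3 = pat4 8 k) ∨
          (pat4 8 j = pat4 8 3 ∧ pat4 8 0 = pat4 8 k)) ↔ pat4 i j = pat4 i k) then cell (Function.update w s(a, y) 0) a b c y 8 else 0) +
      (if (∀ j k : Fin 4, ((pat4 9 j = pat4 9 k) ∨ (pat4 9 j = pat4 9 0 ∧ pat4 9 3 = pat4 9 k) ∨
          (pat4 9 j = pat4 9 3 ∧ pat4 9 0 = pat4 9 k)) ↔ pat4 i j = pat4 i k) then cell (Function.update w s(a, y) 0) a b c y 9 else 0) +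
      (if (∀ j k : Fin 4, ((pat4 10 j = pat4 10 k) ∨ (pat4 10 j = pat4 10 0 ∧ pat4 10 3 = pat4 10 k) ∨
          (pat4 10 j = pat4 10 3 ∧ pat4 10 0 = pat4 10 k)) ↔ pat4 i j = pat4 i k) then cell (Function.update w s(a, y) 0) a b c y 10 else 0) +
      (if (∀ j k : Fin 4, ((pat4 11 j = pat4 11 k) ∨ (pat4 11 j = pat4 11 0 ∧ pat4 11 3 = pat4 11 k) ∨
          (pat4 11 j = pat4 11 3 ∧ pat4 11 0 = pat4 11 k)) ↔ pat4 i j = pat4 i k) then cell (Function.update w s(a, y) 0) a b c y 11 else 0) +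
      (if (∀ j k : Fin 4, ((pat4 12 j = pat4 12 k) ∨ (pat4 12 j = pat4 12 0 ∧ pat4 12 3 = pat4 12 k) ∨
          (pat4 12 j = pat4 12 3 ∧ pat4 12 0 = pat4 12 k)) ↔ pat4 i j = pat4 i k) then cell (Function.update w s(a, y) 0) a b c y 12 else 0) +
      (if (∀ j k : Fin 4, ((pat4 13 j = pat4 13 k) ∨ (pat4 13 j = pat4 13 0 ∧ pat4 13 3 = pat4 13 k) ∨
          (pat4 13 j = pat4 13 3 ∧ pat4 13 0 = pat4 13 k)) ↔ pat4 i j = pat4 i k) then cell (Function.update w s(a, y) 0) a b c y 13 else 0) +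
      (if (∀ j k : Fin 4, ((pat4 14 j = pat4 14 k) ∨ (pat4 14 j = pat4 14 0 ∧ pat4 14 3 = pat4 14 k) ∨
          (pat4 14 j = pat4 14 3 ∧ pat4 14 0 = pat4 14 k)) ↔ pat4 i j = pat4 i k) then cell (Function.update w s(a, y) 0) a b c y 14 else 0) := by
  have glue : (prodBernoulli (Function.update w s(a, y) 1)).real (atom (quad a b c y) (pat4 i)) =
      (prodBernoulli (Function.update w s(a, y) 0)).real
        {ω : BondConfig (Fin n) | insert s(a, y) ω ∈ atom (quad a b c y) (pat4 i)} := by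
    have h1 : Function.update w s(a, y) 1 = Function.update (Function.update w s(a, y) 0) s(a, y) 1 := by
      simp only [Function.update_idem]
    rw [h1]
    exact prodBernoulli_real_update_one_eq (TargetExploration.determinedBy_univ _) (Function.update w s(a, y) 0)
      (Finset.mem_univ _)
  unfold cell
  rw [glue, measureReal_eq_cellSum (Function.update w s(a, y) 0) a b c y (hasPattern_insert_ay a b c y (pat4 i))]
  rfl

/-- The atoms of the relabelled quadruple `(a y b c)` as pattern events of `(a,b,c,y)`. [this work] -/
theorem hasPattern_atom_aybc (a b c y : Fin n) (π₀ : Fin 4 → Fin 4) :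
    HasPattern (quad a b c y) (atom (quad a y b c) π₀)
      (fun π => ∀ j k : Fin 4, π ((![0, 3, 1, 2] : Fin 4 → Fin 4) j) = π ((![0, 3, 1, 2] : Fin 4 → Fin 4) k) ↔ π₀ j = π₀ k) := by
  intro π _ ω hω
  simp only [mem_atom]
  have hq : ∀ j : Fin 4, quad a y b c j = quad a b c y ((![0, 3, 1, 2] : Fin 4 → Fin 4) j) := by
    intro j; fin_cases j <;> rfl
  constructor
  · intro h j k; rw [← hω, ← hq, ← hq]; exact h j k
  · intro h j k; rw [hq, hq, hω]; exact h j k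

/-- Cells of the relabelled quadruple `(a y b c)` in the cells of `(a,b,c,y)`. [this work] -/
theorem cell_relabel_aybc (w : Sym2 (Fin n) → unitInterval) (a b c y : Fin n) (i : Fin 15) :
    cell w a y b c i =
      (if (∀ j k : Fin 4, pat4 0 ((![0, 3, 1, 2] : Fin 4 → Fin 4) j) = pat4 0 ((![0, 3, 1, 2] : Fin 4 → Fin 4) k) ↔ pat4 i j = pat4 i k) then cell w a b c y 0 else 0) +
      (if (∀ j k : Fin 4, pat4 1 ((![0, 3, 1, 2] : Fin 4 → Fin 4) j) = pat4 1 ((![0, 3, 1, 2] : Fin 4 → Fin 4) k) ↔ pat4 i j = pat4 i k) then cell w a b c y 1 else 0) +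
      (if (∀ j k : Fin 4, pat4 2 ((![0, 3, 1, 2] : Fin 4 → Fin 4) j) = pat4 2 ((![0, 3, 1, 2] : Fin 4 → Fin 4) k) ↔ pat4 i j = pat4 i k) then cell w a b c y 2 else 0) +
      (if (∀ j k : Fin 4, pat4 3 ((![0, 3, 1, 2] : Fin 4 → Fin 4) j) = pat4 3 ((![0, 3, 1, 2] : Fin 4 → Fin 4) k) ↔ pat4 i j = pat4 i k) then cell w a b c y 3 else 0) +
      (if (∀ j k : Fin 4, pat4 4 ((![0, 3, 1, 2] : Fin 4 → Fin 4) j) = pat4 4 ((![0, 3, 1, 2] : Fin 4 → Fin 4) k) ↔ pat4 i j = pat4 i k) then cell w a b c y 4 else 0) +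
      (if (∀ j k : Fin 4, pat4 5 ((![0, 3, 1, 2] : Fin 4 → Fin 4) j) = pat4 5 ((![0, 3, 1, 2] : Fin 4 → Fin 4) k) ↔ pat4 i j = pat4 i k) then cell w a b c y 5 else 0) +
      (if (∀ j k : Fin 4, pat4 6 ((![0, 3, 1, 2] : Fin 4 → Fin 4) j) = pat4 6 ((![0, 3, 1, 2] : Fin 4 → Fin 4) k) ↔ pat4 i j = pat4 i k) then cell w a b c y 6 else 0) +
      (if (∀ j k : Fin 4, pat4 7 ((![0, 3, 1, 2] : Fin 4 → Fin 4) j) = pat4 7 ((![0, 3, 1, 2] : Fin 4 → Fin 4) k) ↔ pat4 i j = pat4 i k) then cell w a b c y 7 else 0) +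
      (if (∀ j k : Fin 4, pat4 8 ((![0, 3, 1, 2] : Fin 4 → Fin 4) j) = pat4 8 ((![0, 3, 1, 2] : Fin 4 → Fin 4) k) ↔ pat4 i j = pat4 i k) then cell w a b c y 8 else 0) +
      (if (∀ j k : Fin 4, pat4 9 ((![0, 3, 1, 2] : Fin 4 → Fin 4) j) = pat4 9 ((![0, 3, 1, 2] : Fin 4 → Fin 4) k) ↔ pat4 i j = pat4 i k) then cell w a b c y 9 else 0) +
      (if (∀ j k : Fin 4, pat4 10 ((![0, 3, 1, 2] : Fin 4 → Fin 4) j) = pat4 10 ((![0, 3, 1, 2] : Fin 4 → Fin 4) k) ↔ pat4 i j = pat4 i k) then cell w a b c y 10 else 0) +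
      (if (∀ j k : Fin 4, pat4 11 ((![0, 3, 1, 2] : Fin 4 → Fin 4) j) = pat4 11 ((![0, 3, 1, 2] : Fin 4 → Fin 4) k) ↔ pat4 i j = pat4 i k) then cell w a b c y 11 else 0) +
      (if (∀ j k : Fin 4, pat4 12 ((![0, 3, 1, 2] : Fin 4 → Fin 4) j) = pat4 12 ((![0, 3, 1, 2] : Fin 4 → Fin 4) k) ↔ pat4 i j = pat4 i k) then cell w a b c y 12 else 0) +
      (if (∀ j k : Fin 4, pat4 13 ((![0, 3, 1, 2] : Fin 4 → Fin 4) j) = pat4 13 ((![0, 3, 1, 2] : Fin 4 → Fin 4) k) ↔ pat4 i j = pat4 i k) then cell w a b c y 13 else 0) +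
      (if (∀ j k : Fin 4, pat4 14 ((![0, 3, 1, 2] : Fin 4 → Fin 4) j) = pat4 14 ((![0, 3, 1, 2] : Fin 4 → Fin 4) k) ↔ pat4 i j = pat4 i k) then cell w a b c y 14 else 0) := by
  unfold cell
  rw [measureReal_eq_cellSum w a b c y (hasPattern_atom_aybc a b c y (pat4 i))]
  rfl

/-- The atoms of the relabelled quadruple `(b c y a)` as pattern events of `(a,b,c,y)`. [this work] -/
theorem hasPattern_atom_bcya (a b c y : Fin n) (π₀ : Fin 4 → Fin 4) :
    HasPattern (quad a b c y) (atom (quad b c y a) π₀)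
      (fun π => ∀ j k : Fin 4, π ((![1, 2, 3, 0] : Fin 4 → Fin 4) j) = π ((![1, 2, 3, 0] : Fin 4 → Fin 4) k) ↔ π₀ j = π₀ k) := by
  intro π _ ω hω
  simp only [mem_atom]
  have hq : ∀ j : Fin 4, quad b c y a j = quad a b c y ((![1, 2, 3, 0] : Fin 4 → Fin 4) j) := by
    intro j; fin_cases j <;> rfl
  constructor
  · intro h j k; rw [← hω, ← hq, ← hq]; exact h j k
  · intro h j k; rw [hq, hq, hω]; exact h j k

/-- Cells of the relabelled quadruple `(b c y a)` in the cells of `(a,b,c,y)`. [this work] -/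
theorem cell_relabel_bcya (w : Sym2 (Fin n) → unitInterval) (a b c y : Fin n) (i : Fin 15) :
    cell w b c y a i =
      (if (∀ j k : Fin 4, pat4 0 ((![1, 2, 3, 0] : Fin 4 → Fin 4) j) = pat4 0 ((![1, 2, 3, 0] : Fin 4 → Fin 4) k) ↔ pat4 i j = pat4 i k) then cell w a b c y 0 else 0) +
      (if (∀ j k : Fin 4, pat4 1 ((![1, 2, 3, 0] : Fin 4 → Fin 4) j) = pat4 1 ((![1, 2, 3, 0] : Fin 4 → Fin 4) k) ↔ pat4 i j = pat4 i k) then cell w a b c y 1 else 0) +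
      (if (∀ j k : Fin 4, pat4 2 ((![1, 2, 3, 0] : Fin 4 → Fin 4) j) = pat4 2 ((![1, 2, 3, 0] : Fin 4 → Fin 4) k) ↔ pat4 i j = pat4 i k) then cell w a b c y 2 else 0) +
      (if (∀ j k : Fin 4, pat4 3 ((![1, 2, 3, 0] : Fin 4 → Fin 4) j) = pat4 3 ((![1, 2, 3, 0] : Fin 4 → Fin 4) k) ↔ pat4 i j = pat4 i k) then cell w a b c y 3 else 0) +
      (if (∀ j k : Fin 4, pat4 4 ((![1, 2, 3, 0] : Fin 4 → Fin 4) j) = pat4 4 ((![1, 2, 3, 0] : Fin 4 → Fin 4) k) ↔ pat4 i j = pat4 i k) then cell w a b c y 4 else 0) +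
      (if (∀ j k : Fin 4, pat4 5 ((![1, 2, 3, 0] : Fin 4 → Fin 4) j) = pat4 5 ((![1, 2, 3, 0] : Fin 4 → Fin 4) k) ↔ pat4 i j = pat4 i k) then cell w a b c y 5 else 0) +
      (if (∀ j k : Fin 4, pat4 6 ((![1, 2, 3, 0] : Fin 4 → Fin 4) j) = pat4 6 ((![1, 2, 3, 0] : Fin 4 → Fin 4) k) ↔ pat4 i j = pat4 i k) then cell w a b c y 6 else 0) +
      (if (∀ j k : Fin 4, pat4 7 ((![1, 2, 3, 0] : Fin 4 → Fin 4) j) = pat4 7 ((![1, 2, 3, 0] : Fin 4 → Fin 4) k) ↔ pat4 i j = pat4 i k) then cell w a b c y 7 else 0) +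
      (if (∀ j k : Fin 4, pat4 8 ((![1, 2, 3, 0] : Fin 4 → Fin 4) j) = pat4 8 ((![1, 2, 3, 0] : Fin 4 → Fin 4) k) ↔ pat4 i j = pat4 i k) then cell w a b c y 8 else 0) +
      (if (∀ j k : Fin 4, pat4 9 ((![1, 2, 3, 0] : Fin 4 → Fin 4) j) = pat4 9 ((![1, 2, 3, 0] : Fin 4 → Fin 4) k) ↔ pat4 i j = pat4 i k) then cell w a b c y 9 else 0) +
      (if (∀ j k : Fin 4, pat4 10 ((![1, 2, 3, 0] : Fin 4 → Fin 4) j) = pat4 10 ((![1, 2, 3, 0] : Fin 4 → Fin 4) k) ↔ pat4 i j = pat4 i k) then cell w a b c y 10 else 0) +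
      (if (∀ j k : Fin 4, pat4 11 ((![1, 2, 3, 0] : Fin 4 → Fin 4) j) = pat4 11 ((![1, 2, 3, 0] : Fin 4 → Fin 4) k) ↔ pat4 i j = pat4 i k) then cell w a b c y 11 else 0) +
      (if (∀ j k : Fin 4, pat4 12 ((![1, 2, 3, 0] : Fin 4 → Fin 4) j) = pat4 12 ((![1, 2, 3, 0] : Fin 4 → Fin 4) k) ↔ pat4 i j = pat4 i k) then cell w a b c y 12 else 0) +
      (if (∀ j k : Fin 4, pat4 13 ((![1, 2, 3, 0] : Fin 4 → Fin 4) j) = pat4 13 ((![1, 2, 3, 0] : Fin 4 → Fin 4) k) ↔ pat4 i j = pat4 i k) then cell w a b c y 13 else 0) +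
      (if (∀ j k : Fin 4, pat4 14 ((![1, 2, 3, 0] : Fin 4 → Fin 4) j) = pat4 14 ((![1, 2, 3, 0] : Fin 4 → Fin 4) k) ↔ pat4 i j = pat4 i k) then cell w a b c y 14 else 0) := by
  unfold cell
  rw [measureReal_eq_cellSum w a b c y (hasPattern_atom_bcya a b c y (pat4 i))]
  rfl

/-- **E-MONO-A along the pencil of `s(a,c)`** (all `n`): the `b↔c` image of `pencil_ab`; the defect is nonnegative by
the type-D instance `μ(a|by|c)μ(ab|cy) ≤ μ(ab|c|y)μ(a|bcy)`. [this work] -/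
theorem pencil_ac (w : Sym2 (Fin n) → unitInterval) (a b c y : Fin n) :
    bil (Function.update w s(a, c) 0) (Function.update w s(a, c) 0) a b c y ≤
      bil (Function.update w s(a, c) 0) (Function.update w s(a, c) 1) a b c y +
        bil (Function.update w s(a, c) 1) (Function.update w s(a, c) 0) a b c y := by
  have hD := FourPointExchange.typeD_cell (Function.update w s(a, c) 0) a c b y
  rw [Q44TopGood.cell_relabel_acby _ a b c y 1, Q44TopGood.cell_relabel_acby _ a b c y 9, Q44TopGood.cell_relabel_acby _ a b c y 5,
    Q44TopGood.cell_relabel_acby _ a b c y 7] at hD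
  simp (config := {decide := true}) only [ite_true, ite_false, add_zero, zero_add] at hD
  have h0 := cell_update_one_ac w a b c y 0; have h1 := cell_update_one_ac w a b c y 1
  have h5 := cell_update_one_ac w a b c y 5; have h6 := cell_update_one_ac w a b c y 6
  have h7 := cell_update_one_ac w a b c y 7; have h8 := cell_update_one_ac w a b c y 8
  have h9 := cell_update_one_ac w a b c y 9; have h11 := cell_update_one_ac w a b c y 11
  have h14 := cell_update_one_ac w a b c y 14
  simp (config := {decide := true}) only [ite_true, ite_false, add_zero, zero_add] at h0 h1 h5 h6 h7 h8 h9 h11 h14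
  have p := fun i => cell_nonneg (Function.update w s(a, c) 0) a b c y i
  unfold bil
  rw [h0, h1, h5, h6, h7, h8, h9, h11, h14]
  nlinarith [hD, p 0, p 1, p 2, p 3, p 4, p 5, p 6, p 7, p 8, p 9, p 10, p 11, p 12, p 13, p 14,
    mul_nonneg (p 0) (p 8), mul_nonneg (p 0) (p 12), mul_nonneg (p 0) (p 2), mul_nonneg (p 6) (p 7), mul_nonneg (p 6) (p 8),
    mul_nonneg (p 8) (p 11)]

/-- **E-MONO-A along the pencil of `s(a,y)`** (all `n`): the defect is nonnegative by two type-B instances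
(`μ(a|bc|y)μ(a|b|cy) ≤ μ(⊥)μ(a|bcy)`, `μ(a|bc|y)μ(ab|c|y) ≤ μ(⊥)μ(abc|y)`) and one type-D instance
(`μ(a|bc|y)μ(ab|cy) ≤ μ(ab|c|y)μ(a|bcy)`). [this work] -/
theorem pencil_ay (w : Sym2 (Fin n) → unitInterval) (a b c y : Fin n) :
    bil (Function.update w s(a, y) 0) (Function.update w s(a, y) 0) a b c y ≤
      bil (Function.update w s(a, y) 0) (Function.update w s(a, y) 1) a b c y +
        bil (Function.update w s(a, y) 1) (Function.update w s(a, y) 0) a b c y := by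
  -- type B with hub b (i=a,k=c, y isolated): cell6*cell3 <= cell0*cell13
  have hB1 := FourPointExchange.typeB_cell (Function.update w s(a, y) 0) a b c y
  -- type B with hub c (i=b,k=y, a isolated): via the relabelling (b,c,y,a)
  have hB2 := FourPointExchange.typeB_cell (Function.update w s(a, y) 0) b c y a
  rw [cell_relabel_bcya _ a b c y 6, cell_relabel_bcya _ a b c y 3, cell_relabel_bcya _ a b c y 0,
    cell_relabel_bcya _ a b c y 13] at hB2
  simp (config := {decide := true}) only [ite_true, ite_false, add_zero, zero_add] at hB2
  -- type D with roles (a,y,b,c): μ(a|bc|y)μ(ab|cy) ≤ μ(ab|c|y)μ(a|bcy)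
  have hD := FourPointExchange.typeD_cell (Function.update w s(a, y) 0) a y b c
  rw [cell_relabel_aybc _ a b c y 1, cell_relabel_aybc _ a b c y 9, cell_relabel_aybc _ a b c y 5,
    cell_relabel_aybc _ a b c y 7] at hD
  simp (config := {decide := true}) only [ite_true, ite_false, add_zero, zero_add] at hD
  have h0 := cell_update_one_ay w a b c y 0; have h1 := cell_update_one_ay w a b c y 1
  have h5 := cell_update_one_ay w a b c y 5; have h6 := cell_update_one_ay w a b c y 6
  have h7 := cell_update_one_ay w a b c y 7; have h8 := cell_update_one_ay w a b c y 8
  have h9 := cell_update_one_ay w a b c y 9; have h11 := cell_update_one_ay w a b c y 11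
  have h14 := cell_update_one_ay w a b c y 14
  simp (config := {decide := true}) only [ite_true, ite_false, add_zero, zero_add] at h0 h1 h5 h6 h7 h8 h9 h11 h14
  have p := fun i => cell_nonneg (Function.update w s(a, y) 0) a b c y i
  unfold bil
  rw [h0, h1, h5, h6, h7, h8, h9, h11, h14]
  nlinarith [hB1, hB2, hD, p 0, p 1, p 2, p 3, p 4, p 5, p 6, p 7, p 8, p 9, p 10, p 11, p 12, p 13, p 14,
    mul_nonneg (p 0) (p 7), mul_nonneg (p 0) (p 9), mul_nonneg (p 0) (p 13), mul_nonneg (p 6) (p 1),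
    mul_nonneg (p 7) (p 6), mul_nonneg (p 7) (p 5), mul_nonneg (p 9) (p 11)]

end SingleSourceLaw

end Summit.CriticalPhenomena.PercolationContinuityZ3.Theorems
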